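import Summits.BirchSwinnertonDyer.BirchSwinnertonDyer.Theorems.CMKolyvaginAtInertTwoSilentSupplyOfPrimeTwistSupply
import Summits.BirchSwinnertonDyer.BirchSwinnertonDyer.Theorems.CMKolyvaginAtInertTwoCMPrimitiveSupplyAtInertTwoOfKolyvaginConjecture
import Summits.BirchSwinnertonDyer.BirchSwinnertonDyer.Theorems.GenusKolyvaginAtTwoGenusPrimitiveSupplyAtTwoTwistingPrime
import Summits.BirchSwinnertonDyer.BirchSwinnertonDyer.Theorems.GenusKolyvaginAtTwoMazurRubinCor34iSingleton
import Literature.NumberTheory.EllipticCurves.SelmerTrivialCorankProofs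
import Literature.NumberTheory.EllipticCurves.BSDSelmerCMPConverse
import Literature.NumberTheory.EllipticCurves.AnalyticRankOrderProofs
import Summits.BirchSwinnertonDyer.BirchSwinnertonDyer.Theorems.CMKolyvaginAtInertTwoLevelZeroOneBitBSDTwoOfPrintedInputs
import Summits.BirchSwinnertonDyer.BirchSwinnertonDyer.Theorems.CMKolyvaginAtInertTwoShaCountCompositeAtTwo
import Literature.NumberTheory.EllipticCurves.BSDRankZeroDensityProofs
import Literature.NumberTheory.EllipticCurves.BSDSelmerCMPConverseRankOneProofs
import HarnessLib

/-!
# Route `CMKolyvaginAtInertTwo` (leaf `WAllCornerFTwo`, habitat H₂) — THE HL′-FREE HABITAT DOOR ON `#Sel₂(E/ℚ) = 2`: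
# `BSD₂(E)` for every `E ∈ H₂` with `#Sel₂(E/ℚ) = 2`, from the ONE-BIT TRIVIAL-Ш KOLYVAGIN INPUT R0¹ and prints ONLY
# (Gross–Zagier, GZK, modularity, Milne any-model, Burungale–Flach 2024, Burungale–Tian 2026) — no HL′, no Kolyvagin primes, no Prop. 3.7

Seat `bsd-line-cmk2-p1` g23 (cell `bsd-print-cf2`), `--supports stmt-BirchSwinnertonDyer-28176` (helper; closes nothing by name — booking a
class aside is the pen's call).  THEOREMS ONLY (no definition, no named fact, no `sorry`).  BSD is NOT proved by this: CONDITIONAL on R0¹.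

MECHANISM.  `W ∈ H₂` (globally minimal, CM, `2` inert in `F`, `ρ̄_{E,2}` onto, `r_an = 1`, odd Tamagawa product, an optimal odd-Manin frame)
with `#Sel₂(W/ℚ) = 2`.  (1) This seat's `exists_silentHeegnerField…` machinery (Mazur–Rubin twisting prime `ℓ ≡ 7 (8)`, `4N ∣ ℓ + 1`, not
strict — GK2 tree theorems; MR Cor. 3.4 (i) — tree theorem) gives `K = ℚ(√−ℓ)` with `#Sel₂(W^{(d_K)}) = 1`, hence (Burungale–Tian 2026 +
modularity) `L(W^{(d_K)},1) ≠ 0`, and `Σ_W(d_K) = 1`.  (2) `rank W = 1` (GZK) and `#Sel₂(W) = 2^{rank}·#W(ℚ)[2]·#Ш(W)[2]` give `Ш(W)(2) = ⊥`;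
`#Sel₂(W^{(d_K)}) = 1` gives `Ш(W^{(d_K)})(2) = ⊥`; g15's COUNT IDENTITY `#Ш(W_K)(2)·2 = #Ш(W)(2)·#Ш(W^{(d_K)})(2)·2^{Σ}` (mod GZ/GZK/mod/Milne)
then forces `#Ш(W_K)(2) = 1`.  (3) On the frame `(Dt, β, ι, d₁)` (Heegner datum of conductor `1`; `y_K = P(1)` non-torsion by Gross–Zagier)
R0¹ yields `y_K ∉ 2W(K[1])`, i.e. the exponent `M₀ = 0` with `#Ш(W_K)(2) = 2^{2·0}`.  (4) g0's exact descent `cmExactDescentAtTwo_of_facts` with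
the rank-`0` CM twin's `BSD₂` (Burungale–Flach) concludes `BSDp W 2`.

* `exists_mazurRubinHeegnerField_of_natCard_selmerGroup_eq_two` — the field of (1) with ALL its data (`#Sel₂` of the twin `= 1`, `L ≠ 0`,
  `Σ ≤ 1`, odd `d_K ≠ −3`, Heegner).
* **`bsdp_two_onSelmerRankOne_of_oneBitR0_of_printedInputs`** — (six prints) ∧ R0¹ ⟹ `BSDp W 2` for every `W ∈ H₂` with `#Sel₂(W) = 2`
  (R0¹ = the pen's one-bit restriction of 28176, text of `TURNKEY_route_edit_24648_onebit.lean`, spelled out as a hypothesis).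

So on `H₂ ∩ {Ш(E/ℚ)[2] = 0}` the route's `closes` needs neither HL′ (28663) nor KC beyond R0¹: the ONLY open input there is R0¹ itself
(= «Heegner index odd when Ш(E_K)(2) = ⊥» = BSD₂(E) on that regime, g21/p765765).  BSD is not proved; W-ALL is not closed.

References: [MazurRubin2010] Cor. 3.4 (i), Prop. 3.3, Lemma 3.5; [BurungaleTian2026] Thm. 1.1; [BurungaleFlach2024] Thm. 1.1, Cor. 2;
[GrossZagier1986] I (6.3), V.§2; [Milne1972ArithmeticAV] Thm. 1; [Kramer1981] Prop. 3; [SilvermanAEC2009] X.4.2; [GrossLMS1991] §2, §4.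
-/

set_option autoImplicit false
-- the Theorems namespace of this sub repeats the summit name by design (D-0017 nested layout)
set_option linter.dupNamespace false

noncomputable section

open scoped Classical

open WeierstrassCurve NumberField Literature.NumberTheory.EllipticCurves
  Literature.NumberTheory.EllipticCurves.ModularForms
  Literature.NumberTheory.EllipticCurves.Rank1Residual
  Summit.BirchSwinnertonDyer.Rank1Residual
open Summit.BirchSwinnertonDyer.BirchSwinnertonDyer.Theorems.CMExactDescent

namespace Summit.BirchSwinnertonDyer.BirchSwinnertonDyer.Theorems.KolyvaginLowerTwo

/-- **The Mazur–Rubin Heegner field of a member of H₂ with `#Sel₂(E) = 2`, with all its data** (modulo Burungale–Tian 2026 and modularity):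
for `W/ℚ` globally minimal with CM, `2` inert in the CM field, `ρ̄_{W,2}` onto, `#Sel₂(W/ℚ) = 2`, there is an imaginary quadratic `K` with
odd `d_K ≠ −3`, Heegner for `N_W`, `Σ_W(d_K) ≤ 1`, whose twist `W^{(d_K)}` has TRIVIAL `2`-Selmer group and `L(W^{(d_K)},1) ≠ 0`.
(`K = ℚ(√−ℓ)`, `ℓ` a twisting prime with `4N ∣ ℓ + 1` at which `Sel₂(W)` is not strict; Mazur–Rubin Cor. 3.4 (i).)
[cite: MazurRubin2010, Cor. 3.4 (i), Prop. 3.3, Lemma 3.5] [cite: BurungaleTian2026, Thm. 1.1] [cite: GrossLMS1991, §1] -/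
theorem exists_mazurRubinHeegnerField_of_natCard_selmerGroup_eq_two
    (hBT : burungaleTian_analyticRank_eq_zero_of_selmerCorank_eq_zero_of_hasCM) (hmod : hasEntireLFunction_rat)
    (W : WeierstrassCurve ℚ) [W.IsElliptic] [W.IsGloballyMinimal] [NeZero (W.conductorNorm ℤ)]
    (hCM : W.HasCM) (hin : Rank1Residual.CMInert W 2) (hρ2 : W.HasSurjectiveModNGaloisRep 2)
    (hSel : Nat.card (W.selmerGroup 2) = 2) :
    ∃ (K : Type) (_ : Field K) (_ : NumberField K), IsImaginaryQuadratic K ∧ Odd (NumberField.discr K) ∧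
      NumberField.discr K ≠ -3 ∧ SatisfiesHeegnerHypothesis (W.conductorNorm ℤ) K ∧
      (∑ q ∈ (NumberField.discr K).natAbs.primeFactors,
        ((if jacobiSym W.Δ.num q = -1 then 1 else 0) + (if jacobiSym W.Δ.num q = 1 ∧ Even (W.frobeniusTrace q) then 2 else 0)) ≤ 1) ∧
      Nat.card ((W.quadraticTwist (NumberField.discr K : ℚ)).selmerGroup 2) = 1 ∧
      (W.quadraticTwist (NumberField.discr K : ℚ)).entireLFunction 1 ≠ 0 := by
  have hΔ : W.Δ < 0 := KolyvaginEigenTwo.Δ_neg_of_cmInert_two W hCM hin hρ2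
  have hN0 : W.conductorNorm ℤ ≠ 0 := NeZero.ne _
  have hN4 : 4 * W.conductorNorm ℤ ≠ 0 := by omega
  have hSel1 : Nat.card (W.selmerGroup 2) ≠ 1 := by rw [hSel]; norm_num
  obtain ⟨ℓ, hℓF, -, -, hℓ8, hℓp, hns⟩ :=
    GenusKolyTwistingPrime.exists_twistingPrime_not_selmerGroup_le_strictLocalKer W hρ2 hΔ hSel1 hN4 0
  have hℓ : ℓ.Prime := hℓF.out
  have hℓN' : ∀ p : ℕ, p.Prime → p ∣ W.conductorNorm ℤ → p ≠ 2 → (ℓ : ZMod p) = -1 := by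
    intro p _ hp _
    have h : ((ℓ + 1 : ℕ) : ZMod p) = 0 := (ZMod.natCast_eq_zero_iff _ _).mpr (hℓp p (Dvd.dvd.mul_left hp 4))
    rw [Nat.cast_add, Nat.cast_one] at h
    exact eq_neg_of_add_eq_zero_left h
  obtain ⟨-, -, K, _, _, hK, hd, hodd, hd3, hH, h2K, -, -⟩ := GenusKolyTwin.exists_heegnerField_of_prime W hℓ hℓ8 hℓN'
  have hd0 : ((NumberField.discr K : ℤ) : ℚ) ≠ 0 := by exact_mod_cast NumberField.discr_ne_zero K
  haveI := W.isElliptic_quadraticTwist hd0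
  have hcard := (GenusKolyTwin.cor34i_twin_prime_heegner W MazurRubin2010.cor34i_singleton_rat_holds hΔ hK hodd hH h2K hd
    (W.quadraticTwist ((NumberField.discr K : ℤ) : ℚ)) ⟨1, one_smul _ _⟩).2 hns
  rw [hSel] at hcard
  have h1 : Nat.card ((W.quadraticTwist ((NumberField.discr K : ℤ) : ℚ)).selmerGroup 2) = 1 := by omega
  have h0 : (W.quadraticTwist ((NumberField.discr K : ℤ) : ℚ)).selmerCorank 2 = 0 :=
    selmerCorank_eq_zero_of_natCard_selmerGroup_eq_one_factFree (W.quadraticTwist ((NumberField.discr K : ℤ) : ℚ)) 2 h1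
  have hCMd : (W.quadraticTwist ((NumberField.discr K : ℤ) : ℚ)).HasCM :=
    (hasCM_iff_of_j_eq (W.j_quadraticTwist hd0)).mpr hCM
  have hr0 : (W.quadraticTwist ((NumberField.discr K : ℤ) : ℚ)).analyticRank = 0 :=
    hBT (W.quadraticTwist ((NumberField.discr K : ℤ) : ℚ)) hCMd 2 h0
  have hL : (W.quadraticTwist ((NumberField.discr K : ℤ) : ℚ)).entireLFunction 1 ≠ 0 :=
    ((W.quadraticTwist ((NumberField.discr K : ℤ) : ℚ)).analyticRank_eq_zero_iff_holds (hmod _)).mp hr0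
  have hq : (NumberField.discr K).natAbs.Prime := by
    rw [hd, Int.natAbs_neg, Int.natAbs_natCast]
    exact hℓ
  exact ⟨K, _, _, hK, hodd, hd3, hH, sum_defect_le_one_of_prime_of_cmInert_two W hCM hin hρ2 K hK hodd hH hq, h1, hL⟩

/-- **THE HL′-FREE HABITAT DOOR ON `#Sel₂(E) = 2`: (six prints) ∧ R0¹ ⟹ `BSDp W 2`.**  Prints: Gross–Zagier (all levels), GZK, modularity
(`exists_isNewformOf`), Milne any-model, Burungale–Flach (`bsdTriple_of_hasCM_of_L_one_ne_zero`), Burungale–Tian 2026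
(`burungaleTian_analyticRank_eq_zero_of_selmerCorank_eq_zero_of_hasCM`).  `hR0₁` = the one-bit restriction of R0 (28176): on a frame with `Σ ≤ 1`
and `Ш(E_K)(2) = ⊥`, `y_K ∉ 2E(K[1])`.  For `W ∈ H₂` (CM, `2` inert, `ρ̄₂` onto, `r_an = 1`, odd Tamagawa, an optimal odd-Manin frame) with
`#Sel₂(W/ℚ) = 2`: the Mazur–Rubin field `K` of the previous theorem has `Ш(W_K)(2) = ⊥` by the count identity (`Ш(W)(2) = ⊥` from
`rank = 1` and `#Sel₂ = 2`; `Ш(W^{(d_K)})(2) = ⊥` from `#Sel₂ = 1`), R0¹ gives `M₀ = 0`, and g0's exact descent with Burungale–Flach for the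
twin gives `BSDp W 2`.  NO Kolyvagin prime, NO Prop. 3.7 (2), NO HL′.  CONDITIONAL on R0¹ (open) and the prints; closes nothing by name.
[cite: GrossZagier1986, V.§2] [cite: Milne1972ArithmeticAV, Thm. 1] [cite: Kramer1981, Prop. 3] [cite: BurungaleFlach2024, Thm. 1.1 and Cor. 2]
[cite: BurungaleTian2026, Thm. 1.1] [cite: MazurRubin2010, Cor. 3.4 (i)] [cite: SilvermanAEC2009, Thm X.4.2] -/
theorem bsdp_two_onSelmerRankOne_of_oneBitR0_of_printedInputs
    (hGZ : ∀ (N : ℕ) [NeZero N] (W : WeierstrassCurve ℚ) (K : Type) [Field K] [NumberField K], gross_zagier N W K)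
    (hGZK : rank_eq_analyticRank_of_analyticRank_le_one) (hnf : exists_isNewformOf)
    (hMilneC : Milne1972.bsdQuotient_baseChange_quadratic_anyModel) (hBF : bsdTriple_of_hasCM_of_L_one_ne_zero)
    (hBT : burungaleTian_analyticRank_eq_zero_of_selmerCorank_eq_zero_of_hasCM)
    (hR0₁ : ∀ (W : WeierstrassCurve ℚ) [W.IsElliptic] [W.IsGloballyMinimal] [NeZero (W.conductorNorm ℤ)], W.HasCM →
      Literature.NumberTheory.EllipticCurves.Rank1Residual.CMInert W 2 → W.HasSurjectiveModNGaloisRep (2 : ℤ) →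
      W.analyticRank = 1 → Odd W.tamagawaProduct → ∀ (K : Type) [Field K] [NumberField K],
      Literature.NumberTheory.EllipticCurves.IsImaginaryQuadratic K → Odd (NumberField.discr K) → NumberField.discr K ≠ -3 →
      Literature.NumberTheory.EllipticCurves.SatisfiesHeegnerHypothesis (W.conductorNorm ℤ) K →
      (∑ q ∈ (NumberField.discr K).natAbs.primeFactors, ((if jacobiSym W.Δ.num q = -1 then 1 else 0) +
        (if jacobiSym W.Δ.num q = 1 ∧ Even (W.frobeniusTrace q) then 2 else 0)) ≤ 1) →
      ∀ (Dt : Literature.NumberTheory.EllipticCurves.ModularForms.ModularParametrizationData W (W.conductorNorm ℤ)),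
      (∀ z ∈ Dt.L.lattice, ∃ w ∈ Literature.NumberTheory.EllipticCurves.ModularForms.periodLattice Dt.f, z = (Dt.c : ℂ) * w) →
      Odd Dt.c → ∀ (β : ℤ) (ι : K →+* ℂ) (d₁ : Literature.NumberTheory.EllipticCurves.KolyvaginHeegnerData Dt β ι 1),
      ¬ IsOfFinAddOrder d₁.derivedPoint → AddCommGroup.primaryComponent (W.baseChange K).sha 2 = ⊥ →
      ¬ ∃ Q : (W.baseChange (Literature.NumberTheory.EllipticCurves.ringClassField K ι 1)).toAffine.Point,
        (2 : ℤ) • Q = d₁.derivedPoint)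
    (W : WeierstrassCurve ℚ) [W.IsElliptic] [W.IsGloballyMinimal] [NeZero (W.conductorNorm ℤ)]
    (hCM : W.HasCM) (hin : Rank1Residual.CMInert W 2) (hρ2 : W.HasSurjectiveModNGaloisRep 2) (hr : W.analyticRank = 1)
    (hT : Odd W.tamagawaProduct)
    (hopt : ∃ Dt : ModularParametrizationData W (W.conductorNorm ℤ),
      (∀ z ∈ Dt.L.lattice, ∃ w ∈ periodLattice Dt.f, z = (Dt.c : ℂ) * w) ∧ Odd Dt.c)
    (hSel : Nat.card (W.selmerGroup 2) = 2) :
    BSDp W 2 := by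
  haveI : Fact (Nat.Prime 2) := ⟨Nat.prime_two⟩
  have hmod : hasEntireLFunction_rat := hasEntireLFunction_rat_of_exists_isNewformOf hnf
  have hΔ : W.Δ < 0 := KolyvaginEigenTwo.Δ_neg_of_cmInert_two W hCM hin hρ2
  -- (1) the Mazur–Rubin Heegner field
  obtain ⟨K, _, _, hK, hodd, h3, hH, hdef, h1, hL⟩ :=
    exists_mazurRubinHeegnerField_of_natCard_selmerGroup_eq_two hBT hmod W hCM hin hρ2 hSel
  have hd0 : ((NumberField.discr K : ℤ) : ℚ) ≠ 0 := by exact_mod_cast NumberField.discr_ne_zero K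
  haveI := W.isElliptic_quadraticTwist hd0
  -- (3) the frame: `Dt`, `β`, `ι`, a Heegner datum `d₁` of conductor `1`, `y_K = P(1)` of infinite order (Gross–Zagier)
  obtain ⟨Dt, hDt, hc⟩ := hopt
  obtain ⟨β, hβ⟩ := exists_dvd_sq_sub_discr_holds (W.conductorNorm ℤ) K hK hH
  let ι : K →+* ℂ := Classical.choice inferInstance
  obtain ⟨d₁⟩ := exists_kolyvaginHeegnerData_one
    (phi_heegnerTau_mem_singularModuliField_holds (W.conductorNorm ℤ) W K) hK Dt β ι hβ
  have hy : ¬ IsOfFinAddOrder d₁.derivedPoint :=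
    CMSupply.not_isOfFinAddOrder_derivedPoint_one_of_rankOne hnf W K (hGZ _ W K) hK hH hr hL d₁
  -- (2) `Ш(W)(2) = ⊥`, `Ш(W^{(d_K)})(2) = ⊥`, and the count identity ⟹ `#Ш(W_K)(2) = 1`
  have hrank : W.mordellWeilRank = 1 := by rw [(hGZK W (by rw [hr])).1, hr]
  have hdesc := W.natCard_selmerGroup_eq (n := 2) two_ne_zero
  have hSel' : Nat.card (W.selmerGroup ((2 : ℕ) : ℤ)) = 2 := hSel
  rw [hSel', hrank, pow_one] at hdesc
  have hshaTors : Nat.card (W.sha ⊓ AddSubgroup.torsionBy W.galH1 ((2 : ℕ) : ℤ) : AddSubgroup W.galH1) = 1 := by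
    rw [mul_assoc] at hdesc
    have hab := Nat.eq_of_mul_eq_mul_left two_pos ((mul_one 2).trans hdesc)
    exact Nat.eq_one_of_mul_eq_one_left hab.symm
  have hShaW : AddCommGroup.primaryComponent W.sha 2 = ⊥ :=
    primaryComponent_sha_eq_bot_of_inf_torsionBy_eq_bot W 2 (AddSubgroup.eq_bot_of_card_eq _ hshaTors)
  have hShaD : AddCommGroup.primaryComponent (W.quadraticTwist ((NumberField.discr K : ℤ) : ℚ)).sha 2 = ⊥ :=
    primaryComponent_sha_eq_bot_of_natCard_selmerGroup_eq_one (W.quadraticTwist ((NumberField.discr K : ℤ) : ℚ)) 2 h1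
  obtain ⟨-, hid⟩ := ShaCountTwo.card_primaryComponent_sha_two_baseChange_mul_two_eq_of_heegnerData_of_facts hGZ hGZK hmod hMilneC
    W hρ2 K hK hodd hH Dt β ι d₁ hy
  rw [if_neg (not_lt.mpr hΔ.le), hShaW, hShaD, AddSubgroup.card_bot, AddSubgroup.card_bot, one_mul, mul_one, one_mul] at hid
  have hpow1 : 1 ≤ 2 ^ ∑ q ∈ (NumberField.discr K).natAbs.primeFactors,
      ((if jacobiSym W.Δ.num q = -1 then 1 else 0) + (if jacobiSym W.Δ.num q = 1 ∧ Even (W.frobeniusTrace q) then 2 else 0)) :=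
    Nat.one_le_two_pow
  have hpow2 : 2 ^ ∑ q ∈ (NumberField.discr K).natAbs.primeFactors,
      ((if jacobiSym W.Δ.num q = -1 then 1 else 0) + (if jacobiSym W.Δ.num q = 1 ∧ Even (W.frobeniusTrace q) then 2 else 0)) ≤ 2 ^ 1 :=
    Nat.pow_le_pow_right (by norm_num) hdef
  have hshaK : Nat.card (AddCommGroup.primaryComponent (W.baseChange K).sha 2) = 1 := by
    rw [pow_one] at hpow2
    omega
  have hshaK' : Nat.card (AddCommGroup.primaryComponent (W.baseChange K).sha 2) = 2 ^ (2 * 0) := by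
    rw [mul_zero, pow_zero]
    exact hshaK
  haveI hfinK : Finite (AddCommGroup.primaryComponent (W.baseChange K).sha 2) := Nat.finite_of_card_ne_zero (by omega)
  have hbotK : AddCommGroup.primaryComponent (W.baseChange K).sha 2 = ⊥ := AddSubgroup.eq_bot_of_card_eq _ hshaK
  -- R0¹: `y_K ∉ 2W(K[1])`, i.e. `M₀ = 0`
  have hprim : ¬ ∃ Q : (W.baseChange (ringClassField K ι 1)).toAffine.Point, (2 : ℤ) • Q = d₁.derivedPoint :=
    hR0₁ W hCM hin hρ2 hr hT K hK hodd h3 hH hdef Dt hDt hc β ι d₁ hy hbotK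
  have hM₀ : ∃ Q : (W.baseChange (ringClassField K ι 1)).toAffine.Point, ((2 ^ 0 : ℕ) : ℤ) • Q = d₁.derivedPoint :=
    ⟨d₁.derivedPoint, by rw [pow_zero, Nat.cast_one, one_smul]⟩
  have hndiv : ¬ ∃ Q : (W.baseChange (ringClassField K ι 1)).toAffine.Point, ((2 ^ (0 + 1) : ℕ) : ℤ) • Q = d₁.derivedPoint := by
    rw [zero_add, pow_one]
    exact_mod_cast hprim
  -- (4) the twin (`L ≠ 0`, globally minimal CM model of analytic rank `0`, BSD₂ by Burungale–Flach) and g0's exact descent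
  obtain ⟨Wd, _, _, hWd, hcmd, hrd⟩ := CMSupply.exists_minimal_twin_hasCM_analyticRank_zero hnf W hCM K hL
  have hBd : BSDp Wd 2 := Summit.BirchSwinnertonDyer.Rank1Residual.bsdp_cm_rankZero (p := 2) hBF hmod hcmd hrd
  exact cmExactDescentAtTwo_of_facts hGZ hGZK hmod hMilneC W hCM hin hρ2 hr hT K hK hodd h3 hH Dt hDt hc β ι d₁ hy 0 hM₀ hndiv hshaK'
    Wd hWd hBd

end Summit.BirchSwinnertonDyer.BirchSwinnertonDyer.Theorems.KolyvaginLowerTwo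

end
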